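import Literature.NumberTheory.Automorphic.WhittakerODEDecayingSolution
import Literature.NumberTheory.Automorphic.MixedSpaceUnitsMellinProduct
import Mathlib.Analysis.SpecialFunctions.PolarCoord
import Mathlib.Analysis.SpecialFunctions.Gamma.Deligne
import HarnessLib

/-!
# Mellin transforms of the archimedean Kirillov shape functions as Gamma products
# (Jacquet–Langlands (1970), §5 Thm. 5.15, §6 Thm. 6.4; Tate (1967), §2.5)

Topic `NumberTheory/Automorphic`; namespace `Literature.NumberTheory.Automorphic`. Definitions with bodies
and theorems (no named fact, no instance). The analytic toolkit of the archimedean Hecke test vector of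
`GL(2)`: the Kirillov function of the test vector is a product over the places of SHAPE FUNCTIONS

* real place: `t ↦ c₊ Φ(t)` (`t > 0`), `c₋ Φ(|t|)` (`t < 0`) (`realShapeFn c₊ c₋ Φ`) with
  `Φ(u) = u^β e^{-au}` (`expShape`, discrete series) or `Φ(u) = u^β k_ν(u)`, `k_ν = besselMode a ν`
  (`besselShape`, principal / complementary series);
* complex place: `z ↦ |z|^β k_ν(|z|)` (radial);

and this file computes their local Mellin transforms against `|t|^{s - 3/2} dt` resp. `(|z|²)^{s-3/2} dz`
(the measures of `MixedSpaceUnitsMellinProduct.integrable_and_integral_units_prod_mul_norm_cpow`),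
with integrability on a right half-plane, in the form **`A e^{αs} ∏ Γ_ℝ(s + a_j) ∏ Γ_ℂ(s + b_j)`,
`A ≠ 0`** (`IsGammaProduct`), a class closed under products:

* `isGammaProduct_mellin_expShape`: `(c₊ + c₋) a^{-(s+β-½)} Γ(s + β - ½)`;
* `isGammaProduct_mellin_besselShape`: `(c₊ + c₋) 2 a^{-(s+β)} 2^{s+β-2} Γ((s+β+iν)/2) Γ((s+β-iν)/2)`;
* `isGammaProduct_mellin_complexBesselShape`: `2π · (the same at 2s - ½)` (polar coordinates).

## References

* H. Jacquet, R. P. Langlands, *Automorphic Forms on GL(2)*, LNM 114 (1970), §5 Thm. 5.15, §6 Thm. 6.4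
  (the local `L`-factors at the archimedean places as Mellin transforms of Kirillov functions). [JacquetLanglands1970]
* J. Tate, *Fourier analysis in number fields and Hecke's zeta-functions* (1967), §2.5. [TateThesis1967]
-/

noncomputable section

open MeasureTheory Measure Set Filter Real Complex
open scoped Topology ENNReal Classical

namespace Literature.NumberTheory.Automorphic

/-! ### 1. Gamma products `A e^{αs} ∏ Γ_ℝ(s + a_j) ∏ Γ_ℂ(s + b_j)` -/

section GammaProduct

/-- **`f` is a Gamma product on `re s > x₀`**: `f(s) = A e^{αs} ∏_j Γ_ℝ(s + a_j) ∏_j Γ_ℂ(s + b_j)` there, with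
`A ≠ 0`. [cite: JacquetLanglands1970, §5 Thm. 5.15] -/
def IsGammaProduct (x₀ : ℝ) (f : ℂ → ℂ) : Prop :=
  ∃ (A α : ℂ) (d₁ d₂ : ℕ) (a : Fin d₁ → ℂ) (b : Fin d₂ → ℂ), A ≠ 0 ∧
    ∀ s : ℂ, x₀ < s.re → f s = A * Complex.exp (α * s) * ((∏ j, Complex.Gammaℝ (s + a j)) * ∏ j, Complex.Gammaℂ (s + b j))

namespace IsGammaProduct

variable {x₀ x₁ : ℝ} {f g : ℂ → ℂ}

/-- Enlarging the abscissa preserves Gamma products. [folklore] -/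
theorem mono (h : IsGammaProduct x₀ f) (hx : x₀ ≤ x₁) : IsGammaProduct x₁ f := by
  obtain ⟨A, α, d₁, d₂, a, b, hA, hf⟩ := h
  exact ⟨A, α, d₁, d₂, a, b, hA, fun s hs => hf s (lt_of_le_of_lt hx hs)⟩

/-- A function agreeing with a Gamma product on the half-plane is one. [folklore] -/
theorem congr (h : IsGammaProduct x₀ f) (hfg : ∀ s : ℂ, x₀ < s.re → g s = f s) : IsGammaProduct x₀ g := by
  obtain ⟨A, α, d₁, d₂, a, b, hA, hf⟩ := h
  exact ⟨A, α, d₁, d₂, a, b, hA, fun s hs => (hfg s hs).trans (hf s hs)⟩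

/-- Products of Gamma products are Gamma products (concatenate the parameters). [folklore] -/
theorem mul (hf : IsGammaProduct x₀ f) (hg : IsGammaProduct x₀ g) : IsGammaProduct x₀ (fun s => f s * g s) := by
  obtain ⟨A, α, d₁, d₂, a, b, hA, hf⟩ := hf
  obtain ⟨A', α', d₁', d₂', a', b', hA', hg⟩ := hg
  refine ⟨A * A', α + α', d₁ + d₁', d₂ + d₂', Fin.append a a', Fin.append b b', mul_ne_zero hA hA', fun s hs => ?_⟩
  change f s * g s = _
  rw [hf s hs, hg s hs, Fin.prod_univ_add, Fin.prod_univ_add]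
  simp only [Fin.append_left, Fin.append_right]
  rw [add_mul, Complex.exp_add]
  ring

/-- `A e^{αs + β}` with `A ≠ 0` is a Gamma product. [folklore] -/
theorem expLinear (x₀ : ℝ) {A : ℂ} (hA : A ≠ 0) (α β : ℂ) : IsGammaProduct x₀ (fun s => A * Complex.exp (α * s + β)) := by
  refine ⟨A * Complex.exp β, α, 0, 0, Fin.elim0, Fin.elim0, mul_ne_zero hA (Complex.exp_ne_zero β), fun s _ => ?_⟩
  simp only [Finset.univ_eq_empty, Finset.prod_empty, mul_one, Complex.exp_add]
  ring

/-- A non-zero constant is a Gamma product. [folklore] -/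
theorem const (x₀ : ℝ) {A : ℂ} (hA : A ≠ 0) : IsGammaProduct x₀ (fun _ => A) :=
  (expLinear x₀ hA 0 0).congr fun s _ => by rw [zero_mul, zero_add, Complex.exp_zero, mul_one]

/-- `r^{ps + q}` (`r > 0`) is a Gamma product. [folklore] -/
theorem cpow_ofReal (x₀ : ℝ) {r : ℝ} (hr : 0 < r) (p q : ℂ) : IsGammaProduct x₀ (fun s => (r : ℂ) ^ (p * s + q)) := by
  refine (expLinear x₀ one_ne_zero (Real.log r * p) (Real.log r * q)).congr fun s _ => ?_
  rw [Complex.cpow_def_of_ne_zero (Complex.ofReal_ne_zero.mpr hr.ne'), ← Complex.ofReal_log hr.le, one_mul]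
  congr 1
  ring

/-- `Γ_ℝ(s + c)` is a Gamma product. [folklore] -/
theorem Gammaℝ_shift (x₀ : ℝ) (c : ℂ) : IsGammaProduct x₀ (fun s => Complex.Gammaℝ (s + c)) := by
  refine ⟨1, 0, 1, 0, fun _ => c, Fin.elim0, one_ne_zero, fun s _ => ?_⟩
  simp

/-- `Γ_ℂ(s + c)` is a Gamma product. [folklore] -/
theorem Gammaℂ_shift (x₀ : ℝ) (c : ℂ) : IsGammaProduct x₀ (fun s => Complex.Gammaℂ (s + c)) := by
  refine ⟨1, 0, 0, 1, Fin.elim0, fun _ => c, one_ne_zero, fun s _ => ?_⟩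
  simp

/-- `Γ(s + c) = ½ (2π)^{s+c} Γ_ℂ(s + c)` is a Gamma product. [folklore] -/
theorem Gamma_shift (x₀ : ℝ) (c : ℂ) : IsGammaProduct x₀ (fun s => Complex.Gamma (s + c)) := by
  have h2π : (0 : ℝ) < 2 * Real.pi := by positivity
  refine ((expLinear x₀ (A := 1 / 2) (by norm_num) (Real.log (2 * Real.pi)) (Real.log (2 * Real.pi) * c)).mul
    (Gammaℂ_shift x₀ c)).congr fun s _ => ?_
  rw [Complex.Gammaℂ_def]
  have e : Complex.exp (↑(Real.log (2 * Real.pi)) * s + ↑(Real.log (2 * Real.pi)) * c) = (2 * Real.pi : ℂ) ^ (s + c) := by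
    rw [Complex.cpow_def_of_ne_zero (by exact_mod_cast h2π.ne'), show (2 * Real.pi : ℂ) = ((2 * Real.pi : ℝ) : ℂ) by push_cast; rfl,
      ← Complex.ofReal_log h2π.le]
    congr 1; ring
  rw [e, Complex.cpow_neg]
  have hne : (2 * Real.pi : ℂ) ^ (s + c) ≠ 0 := by
    rw [Ne, Complex.cpow_eq_zero_iff, not_and_or]
    exact Or.inl (by exact_mod_cast h2π.ne')
  field_simp

/-- `Γ((s + c)/2) = π^{(s+c)/2} Γ_ℝ(s + c)` is a Gamma product. [folklore] -/
theorem Gamma_half_shift (x₀ : ℝ) (c : ℂ) : IsGammaProduct x₀ (fun s => Complex.Gamma ((s + c) / 2)) := by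
  refine ((expLinear x₀ one_ne_zero (Real.log Real.pi / 2) (Real.log Real.pi / 2 * c)).mul (Gammaℝ_shift x₀ c)).congr
    fun s _ => ?_
  rw [Complex.Gammaℝ_def]
  have e : Complex.exp (↑(Real.log Real.pi) / 2 * s + ↑(Real.log Real.pi) / 2 * c) = (Real.pi : ℂ) ^ ((s + c) / 2) := by
    rw [Complex.cpow_def_of_ne_zero (by exact_mod_cast Real.pi_pos.ne'), ← Complex.ofReal_log Real.pi_pos.le]
    congr 1; ring
  rw [e, one_mul, show -(s + c) / 2 = -((s + c) / 2) by ring, Complex.cpow_neg]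
  have hne : (Real.pi : ℂ) ^ ((s + c) / 2) ≠ 0 := by
    rw [Ne, Complex.cpow_eq_zero_iff, not_and_or]
    exact Or.inl (by exact_mod_cast Real.pi_pos.ne')
  field_simp

/-- Finite products of Gamma products. [folklore] -/
theorem finset_prod {ι : Type*} (S : Finset ι) {F : ι → ℂ → ℂ} (h : ∀ i ∈ S, IsGammaProduct x₀ (F i)) :
    IsGammaProduct x₀ (fun s => ∏ i ∈ S, F i s) := by
  classical
  induction S using Finset.induction_on with
  | empty => exact (const x₀ one_ne_zero).congr fun s _ => by rw [Finset.prod_empty]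
  | @insert i S hi ih =>
    refine ((h i (Finset.mem_insert_self _ _)).mul (ih fun j hj => h j (Finset.mem_insert_of_mem hj))).congr fun s _ => ?_
    rw [Finset.prod_insert hi]

end IsGammaProduct

end GammaProduct

/-! ### 2. Shape functions on the real line and their Mellin transforms -/

section RealShapes

/-- `Φ` on `t > 0`, `0` elsewhere. [folklore] -/
def halfLineFn (Φ : ℝ → ℂ) (t : ℝ) : ℂ := if 0 < t then Φ t else 0

/-- **The real-place shape function** `t ↦ c₊ Φ(t)` (`t > 0`), `c₋ Φ(|t|)` (`t < 0`), `0` at `0`.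
[cite: JacquetLanglands1970, §5 Thm. 5.15] -/
def realShapeFn (cp cm : ℂ) (Φ : ℝ → ℂ) (t : ℝ) : ℂ := cp * halfLineFn Φ t + cm * halfLineFn Φ (-t)

/-- `u^β e^{-au}`. [folklore] -/
def expShape (β : ℂ) (a : ℝ) (u : ℝ) : ℂ := (u : ℂ) ^ β * Complex.exp (-(a : ℂ) * u)

/-- `u^β k_ν(u)`, `k_ν = besselMode a ν` (`= 2√u K_{iν}(au)`). [folklore] -/
def besselShape (β : ℂ) (a : ℝ) (ν : ℂ) (u : ℝ) : ℂ := (u : ℂ) ^ β * besselMode a ν u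

/-- `halfLineFn Φ t = Φ t` for `t > 0`. [folklore] -/
theorem halfLineFn_of_pos {Φ : ℝ → ℂ} {t : ℝ} (ht : 0 < t) : halfLineFn Φ t = Φ t := if_pos ht

/-- `halfLineFn Φ t = 0` for `t ≤ 0`. [folklore] -/
theorem halfLineFn_of_nonpos {Φ : ℝ → ℂ} {t : ℝ} (ht : t ≤ 0) : halfLineFn Φ t = 0 := if_neg (not_lt.mpr ht)

/-- The real shape function on `t > 0` is `c₊ Φ(t)`. [folklore] -/
theorem realShapeFn_of_pos (cp cm : ℂ) (Φ : ℝ → ℂ) {t : ℝ} (ht : 0 < t) : realShapeFn cp cm Φ t = cp * Φ t := by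
  rw [realShapeFn, halfLineFn_of_pos ht, halfLineFn_of_nonpos (by linarith), mul_zero, add_zero]

/-- The real shape function on `t < 0` is `c₋ Φ(-t)`. [folklore] -/
theorem realShapeFn_of_neg (cp cm : ℂ) (Φ : ℝ → ℂ) {t : ℝ} (ht : t < 0) : realShapeFn cp cm Φ t = cm * Φ (-t) := by
  rw [realShapeFn, halfLineFn_of_nonpos ht.le, halfLineFn_of_pos (by linarith), mul_zero, zero_add]

/-- The real shape function vanishes at `0`. [folklore] -/
theorem realShapeFn_zero (cp cm : ℂ) (Φ : ℝ → ℂ) : realShapeFn cp cm Φ 0 = 0 := by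
  rw [realShapeFn, neg_zero, halfLineFn_of_nonpos le_rfl, mul_zero, mul_zero, add_zero]

/-- `halfLineFn Φ` is measurable for `Φ` continuous on `(0, ∞)`. [folklore] -/
theorem measurable_halfLineFn {Φ : ℝ → ℂ} (hΦ : ContinuousOn Φ (Ioi 0)) : Measurable (halfLineFn Φ) := by
  refine measurable_of_continuousOn_compl_singleton 0 fun t ht => ?_
  rcases lt_or_gt_of_ne (show t ≠ 0 from ht) with h | h
  · have he : halfLineFn Φ =ᶠ[𝓝 t] fun _ => 0 :=
      (eventually_lt_nhds h).mono fun u hu => halfLineFn_of_nonpos hu.le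
    exact (continuousAt_const.congr he.symm : ContinuousAt (halfLineFn Φ) t).continuousWithinAt
  · have he : halfLineFn Φ =ᶠ[𝓝 t] Φ := (eventually_gt_nhds h).mono fun u hu => halfLineFn_of_pos hu
    exact ((hΦ.continuousAt (isOpen_Ioi.mem_nhds h)).congr he.symm).continuousWithinAt

/-- The real shape function is measurable. [folklore] -/
theorem measurable_realShapeFn (cp cm : ℂ) {Φ : ℝ → ℂ} (hΦ : ContinuousOn Φ (Ioi 0)) : Measurable (realShapeFn cp cm Φ) :=
  ((measurable_halfLineFn hΦ).const_mul cp).add (((measurable_halfLineFn hΦ).comp measurable_neg).const_mul cm)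

/-- Pointwise: `F(t) |t|^{w} = c₊ g(t) + c₋ g(-t)` with `g = 𝟙_{(0,∞)} Φ(u) u^{w}`. [folklore] -/
theorem realShapeFn_mul_abs_cpow (cp cm : ℂ) (Φ : ℝ → ℂ) (w : ℂ) (t : ℝ) :
    realShapeFn cp cm Φ t * ((|t| : ℝ) : ℂ) ^ w =
      cp * (Ioi (0 : ℝ)).indicator (fun u => Φ u * (u : ℂ) ^ w) t + cm * (Ioi (0 : ℝ)).indicator (fun u => Φ u * (u : ℂ) ^ w) (-t) := by
  rcases lt_trichotomy t 0 with h | rfl | h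
  · rw [realShapeFn_of_neg cp cm Φ h, indicator_of_notMem (show t ∉ Ioi (0 : ℝ) from not_lt.mpr h.le),
      indicator_of_mem (show -t ∈ Ioi (0 : ℝ) by simpa using h), abs_of_neg h, mul_zero, zero_add, mul_assoc]
  · rw [realShapeFn_zero, zero_mul, neg_zero, indicator_of_notMem (show (0 : ℝ) ∉ Ioi (0 : ℝ) from fun h => lt_irrefl (0 : ℝ) h), mul_zero,
      mul_zero, add_zero]
  · rw [realShapeFn_of_pos cp cm Φ h, indicator_of_mem (show t ∈ Ioi (0 : ℝ) from h),
      indicator_of_notMem (show -t ∉ Ioi (0 : ℝ) by simp [h.le]), abs_of_pos h, mul_zero, add_zero, mul_assoc]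

/-- **Integrability of `F(t) |t|^{w}` on `ℝ`** from that of `Φ(u) u^{w}` on `(0, ∞)`. [folklore] -/
theorem integrable_realShapeFn_mul (cp cm : ℂ) {Φ : ℝ → ℂ} (w : ℂ) (hint : IntegrableOn (fun u => Φ u * (u : ℂ) ^ w) (Ioi 0)) :
    Integrable fun t : ℝ => realShapeFn cp cm Φ t * ((|t| : ℝ) : ℂ) ^ w := by
  have hg : Integrable ((Ioi (0 : ℝ)).indicator fun u => Φ u * (u : ℂ) ^ w) := (integrable_indicator_iff measurableSet_Ioi).2 hint
  have h := (hg.const_mul cp).add ((hg.comp_neg).const_mul cm)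
  refine h.congr (Eventually.of_forall fun t => ?_)
  exact (realShapeFn_mul_abs_cpow cp cm Φ w t).symm

/-- **`∫_ℝ F(t) |t|^{w} dt = (c₊ + c₋) ∫₀^∞ Φ(u) u^{w} du`.** [folklore] -/
theorem integral_realShapeFn_mul (cp cm : ℂ) {Φ : ℝ → ℂ} (w : ℂ) (hint : IntegrableOn (fun u => Φ u * (u : ℂ) ^ w) (Ioi 0)) :
    ∫ t : ℝ, realShapeFn cp cm Φ t * ((|t| : ℝ) : ℂ) ^ w = (cp + cm) * ∫ u in Ioi (0 : ℝ), Φ u * (u : ℂ) ^ w := by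
  have hg : Integrable ((Ioi (0 : ℝ)).indicator fun u => Φ u * (u : ℂ) ^ w) := (integrable_indicator_iff measurableSet_Ioi).2 hint
  simp_rw [realShapeFn_mul_abs_cpow]
  rw [integral_add (hg.const_mul cp) ((hg.comp_neg).const_mul cm), integral_const_mul, integral_const_mul]
  have hneg : ∫ t : ℝ, (Ioi (0 : ℝ)).indicator (fun u => Φ u * (u : ℂ) ^ w) (-t) = ∫ t : ℝ, (Ioi (0 : ℝ)).indicator (fun u => Φ u * (u : ℂ) ^ w) t :=
    integral_neg_eq_self (fun t => (Ioi (0 : ℝ)).indicator (fun u => Φ u * (u : ℂ) ^ w) t) volume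
  rw [hneg, integral_indicator measurableSet_Ioi]
  ring

/-! #### The two shapes -/

/-- `u^β e^{-au}` is continuous on `(0,∞)`. [folklore] -/
theorem continuousOn_expShape (β : ℂ) (a : ℝ) : ContinuousOn (expShape β a) (Ioi 0) := by
  intro u hu
  refine ContinuousAt.continuousWithinAt ?_
  exact (Complex.continuousAt_ofReal_cpow_const u β (Or.inr (ne_of_gt hu))).mul
    ((Complex.continuous_exp.comp (continuous_const.mul Complex.continuous_ofReal)).continuousAt)

/-- `u^β k_ν(u)` is continuous on `(0,∞)`. [folklore] -/
theorem continuousOn_besselShape (β : ℂ) {a : ℝ} (ha : 0 < a) (ν : ℂ) : ContinuousOn (besselShape β a ν) (Ioi 0) := by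
  intro u hu
  refine ContinuousAt.continuousWithinAt ?_
  exact (Complex.continuousAt_ofReal_cpow_const u β (Or.inr (ne_of_gt hu))).mul (hasDerivAt_besselMode ν hu ha).continuousAt

/-- On `(0,∞)`: `u^β e^{-au} u^{s - 3/2} = u^{(s+β-½)-1} e^{-(au)}`. [folklore] -/
theorem expShape_mul_cpow {u : ℝ} (hu : 0 < u) (β : ℂ) (a : ℝ) (s : ℂ) :
    expShape β a u * (u : ℂ) ^ (s - 3 / 2) = (u : ℂ) ^ (s + β - 1 / 2 - 1) * Complex.exp (-((a : ℂ) * u)) := by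
  have hu0 : (u : ℂ) ≠ 0 := Complex.ofReal_ne_zero.mpr hu.ne'
  rw [expShape, show s + β - 1 / 2 - 1 = β + (s - 3 / 2) by ring, Complex.cpow_add _ _ hu0, neg_mul]
  ring

/-- **Integrability of `u^β e^{-au} u^{s-3/2}` on `(0,∞)`** for `re(s + β - ½) > 0`. [folklore] -/
theorem integrableOn_expShape_mul {a : ℝ} (ha : 0 < a) {β s : ℂ} (hs : 0 < (s + β - 1 / 2).re) :
    IntegrableOn (fun u => expShape β a u * (u : ℂ) ^ (s - 3 / 2)) (Ioi 0) := by
  have hcongr : EqOn (fun u : ℝ => (u : ℂ) ^ (s + β - 1 / 2 - 1) * Complex.exp (-((a : ℂ) * u)))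
      (fun u => expShape β a u * (u : ℂ) ^ (s - 3 / 2)) (Ioi 0) := fun u hu => (expShape_mul_cpow hu β a s).symm
  refine IntegrableOn.congr_fun ?_ hcongr measurableSet_Ioi
  -- dominate by the real integrand `u^{re - 1} e^{-au}`
  have hreal : IntegrableOn (fun u : ℝ => u ^ ((s + β - 1 / 2).re - 1) * Real.exp (-a * u ^ (1 : ℝ))) (Ioi 0) :=
    integrableOn_rpow_mul_exp_neg_mul_rpow (by linarith) le_rfl ha
  have hmeas : AEStronglyMeasurable (fun u : ℝ => (u : ℂ) ^ (s + β - 1 / 2 - 1) * Complex.exp (-((a : ℂ) * u)))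
      (volume.restrict (Ioi 0)) := by
    refine (ContinuousOn.mul (fun u hu => ?_) ?_).aestronglyMeasurable measurableSet_Ioi
    · exact (Complex.continuousAt_ofReal_cpow_const u _ (Or.inr (ne_of_gt hu))).continuousWithinAt
    · exact (Complex.continuous_exp.comp ((continuous_const.mul Complex.continuous_ofReal).neg)).continuousOn
  refine Integrable.mono' hreal hmeas ?_
  refine (ae_restrict_iff' measurableSet_Ioi).2 (Eventually.of_forall fun u hu => ?_)
  rw [norm_mul, Complex.norm_cpow_eq_rpow_re_of_pos hu, Complex.norm_exp, Real.rpow_one]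
  simp only [Complex.neg_re, Complex.mul_re, Complex.ofReal_re, Complex.ofReal_im, mul_zero, sub_zero, Complex.sub_re,
    Complex.one_re]
  rw [neg_mul]

/-- **`∫₀^∞ u^β e^{-au} u^{s-3/2} du = a^{-(s+β-½)} Γ(s + β - ½)`.** [folklore] -/
theorem integral_expShape_mul {a : ℝ} (ha : 0 < a) {β s : ℂ} (hs : 0 < (s + β - 1 / 2).re) :
    ∫ u in Ioi (0 : ℝ), expShape β a u * (u : ℂ) ^ (s - 3 / 2) = (1 / (a : ℂ)) ^ (s + β - 1 / 2) * Complex.Gamma (s + β - 1 / 2) := by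
  rw [← Complex.integral_cpow_mul_exp_neg_mul_Ioi hs ha]
  exact setIntegral_congr_fun measurableSet_Ioi fun u hu => expShape_mul_cpow hu β a s

/-- On `(0,∞)`: `u^β k_ν(u) u^{s-3/2} = 2 u^{(s+β)-1} K_{iν}(au)`. [folklore] -/
theorem besselShape_mul_cpow {a u : ℝ} (ha : 0 < a) (hu : 0 < u) (β ν s : ℂ) :
    besselShape β a ν u * (u : ℂ) ^ (s - 3 / 2) =
      2 * ((u : ℂ) ^ (s + β - 1) * Literature.Analysis.FunctionSpaces.besselK (Complex.I * ν) ((a * u : ℝ) : ℂ)) := by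
  have hu0 : (u : ℂ) ≠ 0 := Complex.ofReal_ne_zero.mpr hu.ne'
  rw [besselShape, besselMode_eq_two_mul_sqrt_mul_besselK ha hu, Real.sqrt_eq_rpow, Complex.ofReal_cpow hu.le,
    show s + β - 1 = β + ((1 / 2 : ℝ) : ℂ) + (s - 3 / 2) by push_cast; ring, Complex.cpow_add _ _ hu0, Complex.cpow_add _ _ hu0]
  ring

/-- **Integrability of `u^β k_ν(u) u^{s-3/2}` on `(0,∞)`** for `|im ν| < re(s + β)`. [folklore] -/
theorem integrableOn_besselShape_mul {a : ℝ} (ha : 0 < a) {β ν s : ℂ} (h : |ν.im| < (s + β).re) :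
    IntegrableOn (fun u => besselShape β a ν u * (u : ℂ) ^ (s - 3 / 2)) (Ioi 0) := by
  have h' : |(Complex.I * ν).re| < (s + β).re := by rwa [Complex.I_mul_re, abs_neg]
  have hK : IntegrableOn (fun u : ℝ => 2 * ((u : ℂ) ^ (s + β - 1) * Literature.Analysis.FunctionSpaces.besselK (Complex.I * ν) ((a * u : ℝ) : ℂ))) (Ioi 0) :=
    (Literature.Analysis.FunctionSpaces.integrableOn_cpow_mul_besselK_mul (s := s + β) ha h').const_mul (2 : ℂ)
  exact IntegrableOn.congr_fun hK (fun u hu => (besselShape_mul_cpow ha hu β ν s).symm) measurableSet_Ioi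

/-- **`∫₀^∞ u^β k_ν(u) u^{s-3/2} du = 2 a^{-(s+β)} 2^{s+β-2} Γ((s+β+iν)/2) Γ((s+β-iν)/2)`.** [folklore] -/
theorem integral_besselShape_mul {a : ℝ} (ha : 0 < a) {β ν s : ℂ} (h : |ν.im| < (s + β).re) :
    ∫ u in Ioi (0 : ℝ), besselShape β a ν u * (u : ℂ) ^ (s - 3 / 2) =
      2 * ((a : ℂ) ^ (-(s + β)) * ((2 : ℂ) ^ (s + β - 2) * Complex.Gamma ((s + β + Complex.I * ν) / 2) *
        Complex.Gamma ((s + β - Complex.I * ν) / 2))) := by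
  have key := integral_cpow_mul_besselMode ha (s := s) (μ := 2 * β) (w := ν) (by rwa [mul_div_cancel_left₀ β two_ne_zero])
  rw [mul_div_cancel_left₀ β two_ne_zero] at key
  rw [← key]
  refine setIntegral_congr_fun measurableSet_Ioi fun u _ => ?_
  rw [besselShape, show s - 1 / 2 - 1 = s - 3 / 2 by ring]

/-- **The Mellin transform of the real discrete-series shape is a Gamma product**:
`∫_ℝ F |t|^{s-3/2} = (c₊ + c₋) a^{-(s+β-½)} Γ(s+β-½)` for `re s > ½ - re β`, with integrability.
[cite: JacquetLanglands1970, §5 Thm. 5.15] -/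
theorem isGammaProduct_mellin_expShape {a : ℝ} (ha : 0 < a) (β : ℂ) {cp cm : ℂ} (hc : cp + cm ≠ 0) :
    (∀ s : ℂ, 1 / 2 - β.re < s.re → Integrable fun t : ℝ => realShapeFn cp cm (expShape β a) t * ((|t| : ℝ) : ℂ) ^ (s - 3 / 2)) ∧
    IsGammaProduct (1 / 2 - β.re) (fun s => ∫ t : ℝ, realShapeFn cp cm (expShape β a) t * ((|t| : ℝ) : ℂ) ^ (s - 3 / 2)) := by
  have hre : ∀ s : ℂ, 1 / 2 - β.re < s.re → 0 < (s + β - 1 / 2).re := fun s hs => by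
    simp only [Complex.sub_re, Complex.add_re, Complex.div_ofNat_re, Complex.one_re]
    linarith
  refine ⟨fun s hs => integrable_realShapeFn_mul cp cm _ (integrableOn_expShape_mul ha (hre s hs)), ?_⟩
  refine (((IsGammaProduct.const _ hc).mul (IsGammaProduct.cpow_ofReal _ (one_div_pos.mpr ha) 1 (β - 1 / 2))).mul
    (IsGammaProduct.Gamma_shift _ (β - 1 / 2))).congr fun s hs => ?_
  rw [integral_realShapeFn_mul cp cm _ (integrableOn_expShape_mul ha (hre s hs)), integral_expShape_mul ha (hre s hs)]
  push_cast
  ring_nf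

/-- **The Mellin transform of the real Bessel shape is a Gamma product**:
`∫_ℝ F |t|^{s-3/2} = (c₊ + c₋) 2 a^{-(s+β)} 2^{s+β-2} Γ((s+β+iν)/2) Γ((s+β-iν)/2)` for `re s > |im ν| - re β`,
with integrability. [cite: JacquetLanglands1970, §5 Thm. 5.15] -/
theorem isGammaProduct_mellin_besselShape {a : ℝ} (ha : 0 < a) (β ν : ℂ) {cp cm : ℂ} (hc : cp + cm ≠ 0) :
    (∀ s : ℂ, |ν.im| - β.re < s.re → Integrable fun t : ℝ => realShapeFn cp cm (besselShape β a ν) t * ((|t| : ℝ) : ℂ) ^ (s - 3 / 2)) ∧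
    IsGammaProduct (|ν.im| - β.re) (fun s => ∫ t : ℝ, realShapeFn cp cm (besselShape β a ν) t * ((|t| : ℝ) : ℂ) ^ (s - 3 / 2)) := by
  have hre : ∀ s : ℂ, |ν.im| - β.re < s.re → |ν.im| < (s + β).re := fun s hs => by
    rw [Complex.add_re]; linarith
  refine ⟨fun s hs => integrable_realShapeFn_mul cp cm _ (integrableOn_besselShape_mul ha (hre s hs)), ?_⟩
  refine (((((IsGammaProduct.const _ (mul_ne_zero hc two_ne_zero)).mul (IsGammaProduct.cpow_ofReal _ ha (-1) (-β))).mul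
    (IsGammaProduct.cpow_ofReal _ two_pos 1 (β - 2))).mul (IsGammaProduct.Gamma_half_shift _ (β + Complex.I * ν))).mul
    (IsGammaProduct.Gamma_half_shift _ (β - Complex.I * ν))).congr fun s hs => ?_
  rw [integral_realShapeFn_mul cp cm _ (integrableOn_besselShape_mul ha (hre s hs)), integral_besselShape_mul ha (hre s hs)]
  push_cast
  ring_nf

end RealShapes

/-! ### 3. Radial functions on `ℂ` -/

section ComplexShapes

/-- `r ↦ 𝟙_{(0,∞)}(r) r H(r)` is measurable for `H` continuous on `(0,∞)`. [folklore] -/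
theorem measurable_indicator_mul_of_continuousOn {H : ℝ → ℂ} (hH : ContinuousOn H (Ioi 0)) :
    Measurable ((Ioi (0 : ℝ)).indicator fun r : ℝ => (r : ℂ) * H r) := by
  have h : (Ioi (0 : ℝ)).indicator (fun r : ℝ => (r : ℂ) * H r) = halfLineFn fun r : ℝ => (r : ℂ) * H r := by
    funext r
    by_cases hr : 0 < r
    · rw [indicator_of_mem (show r ∈ Ioi (0 : ℝ) from hr), halfLineFn_of_pos hr]
    · rw [indicator_of_notMem (show r ∉ Ioi (0 : ℝ) from hr), halfLineFn_of_nonpos (not_lt.mp hr)]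
  rw [h]
  exact measurable_halfLineFn (Complex.continuous_ofReal.continuousOn.mul hH)

/-- **Integrability of a radial function on `ℂ`** from that of `r H(r)` on `(0,∞)` (polar coordinates).
[folklore] -/
theorem integrable_radial {H : ℝ → ℂ} (hH : ContinuousOn H (Ioi 0)) (hint : IntegrableOn (fun r : ℝ => (r : ℂ) * H r) (Ioi 0)) :
    Integrable fun z : ℂ => H ‖z‖ := by
  -- measurability: continuous off the origin
  have hmeas : Measurable fun z : ℂ => H ‖z‖ := by
    refine measurable_of_continuousOn_compl_singleton 0 fun z hz => ?_
    have hz' : 0 < ‖z‖ := norm_pos_iff.mpr hz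
    exact ((hH.continuousAt (isOpen_Ioi.mem_nhds hz')).comp continuous_norm.continuousAt).continuousWithinAt
  refine ⟨hmeas.aestronglyMeasurable, ?_⟩
  -- finite integral via polar coordinates
  rw [hasFiniteIntegral_iff_enorm, ← Complex.lintegral_comp_polarCoord_symm, polarCoord_target]
  set g : ℝ → ℝ≥0∞ := fun r => ‖(Ioi (0 : ℝ)).indicator (fun r : ℝ => (r : ℂ) * H r) r‖ₑ with hg
  have hgm : Measurable g := (measurable_indicator_mul_of_continuousOn hH).enorm
  have hpol : EqOn (fun p : ℝ × ℝ => ENNReal.ofReal p.1 • ‖H ‖Complex.polarCoord.symm p‖‖ₑ)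
      (fun p : ℝ × ℝ => g p.1 * (fun _ : ℝ => (1 : ℝ≥0∞)) p.2) (Ioi (0 : ℝ) ×ˢ Ioo (-Real.pi) Real.pi) := by
    intro p hp
    have hp1 : 0 < p.1 := (mem_prod.mp hp).1
    simp only [hg]
    rw [Complex.norm_polarCoord_symm, abs_of_pos hp1, smul_eq_mul, mul_one, indicator_of_mem (show p.1 ∈ Ioi (0 : ℝ) from hp1),
      enorm_mul, ← ofReal_norm (p.1 : ℂ), Complex.norm_real, Real.norm_of_nonneg hp1.le]
  rw [setLIntegral_congr_fun (measurableSet_Ioi.prod measurableSet_Ioo) hpol, Measure.volume_eq_prod, ← Measure.prod_restrict,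
    lintegral_prod_mul hgm.aemeasurable aemeasurable_const]
  refine ENNReal.mul_lt_top ?_ ?_
  · rw [hg, ← lintegral_indicator measurableSet_Ioi]
    have h1 : (fun r => (Ioi (0 : ℝ)).indicator (fun r => ‖(Ioi (0 : ℝ)).indicator (fun r : ℝ => (r : ℂ) * H r) r‖ₑ) r) =
        fun r => ‖(Ioi (0 : ℝ)).indicator (fun r : ℝ => (r : ℂ) * H r) r‖ₑ := by
      funext r
      by_cases hr : r ∈ Ioi (0 : ℝ)
      · rw [indicator_of_mem hr]
      · rw [indicator_of_notMem hr, indicator_of_notMem hr, enorm_zero]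
    rw [h1]
    have h2 := ((integrable_indicator_iff measurableSet_Ioi).2 hint).hasFiniteIntegral
    rwa [hasFiniteIntegral_iff_enorm] at h2
  · rw [setLIntegral_const]
    exact ENNReal.mul_lt_top ENNReal.one_lt_top measure_Ioo_lt_top

/-- For `r > 0`: `r (r²)^{s - 3/2} = r^{(2s - ½) - 3/2}`. [folklore] -/
theorem ofReal_mul_sq_cpow {r : ℝ} (hr : 0 < r) (s : ℂ) :
    (r : ℂ) * (((r ^ 2 : ℝ)) : ℂ) ^ (s - 3 / 2) = (r : ℂ) ^ (2 * s - 1 / 2 - 3 / 2) := by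
  have hr0 : (r : ℂ) ≠ 0 := Complex.ofReal_ne_zero.mpr hr.ne'
  have hr2 : ((r ^ 2 : ℝ) : ℂ) ≠ 0 := Complex.ofReal_ne_zero.mpr (pow_ne_zero 2 hr.ne')
  have e : (((r ^ 2 : ℝ)) : ℂ) ^ (s - 3 / 2) = (r : ℂ) ^ (2 * (s - 3 / 2)) := by
    rw [Complex.cpow_def_of_ne_zero hr2, Complex.cpow_def_of_ne_zero hr0, ← Complex.ofReal_log (pow_nonneg hr.le 2),
      ← Complex.ofReal_log hr.le, Real.log_pow]
    congr 1; push_cast; ring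
  rw [e, show 2 * s - 1 / 2 - 3 / 2 = 1 + 2 * (s - 3 / 2) by ring, Complex.cpow_add _ _ hr0, Complex.cpow_one]

/-- **The Mellin transform over `ℂ` of the radial Bessel shape is a Gamma product**:
`∫_ℂ |z|^β k_ν(|z|) (|z|²)^{s-3/2} dz = 2π · 2 a^{-(S+β)} 2^{S+β-2} Γ((S+β+iν)/2) Γ((S+β-iν)/2)`, `S = 2s - ½`,
for `re s > (|im ν| + ½ - re β)/2`, with integrability. [cite: JacquetLanglands1970, §6 Thm. 6.4] -/
theorem isGammaProduct_mellin_complexBesselShape {a : ℝ} (ha : 0 < a) (β ν : ℂ) :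
    (∀ s : ℂ, (|ν.im| + 1 / 2 - β.re) / 2 < s.re →
      Integrable fun z : ℂ => besselShape β a ν ‖z‖ * ((‖z‖ ^ 2 : ℝ) : ℂ) ^ (s - 3 / 2)) ∧
    IsGammaProduct ((|ν.im| + 1 / 2 - β.re) / 2)
      (fun s => ∫ z : ℂ, besselShape β a ν ‖z‖ * ((‖z‖ ^ 2 : ℝ) : ℂ) ^ (s - 3 / 2)) := by
  -- the radial function and the key identity `r H_s(r) = (r^β k_ν(r)) r^{S - 3/2}`
  have hre : ∀ s : ℂ, (|ν.im| + 1 / 2 - β.re) / 2 < s.re → |ν.im| < (2 * s - 1 / 2 + β).re := fun s hs => by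
    simp only [Complex.add_re, Complex.sub_re, Complex.mul_re, Complex.re_ofNat, Complex.im_ofNat, zero_mul, sub_zero,
      Complex.div_ofNat_re, Complex.one_re]
    linarith
  have hkey : ∀ s : ℂ, EqOn (fun r : ℝ => (r : ℂ) * (besselShape β a ν r * (((r ^ 2 : ℝ)) : ℂ) ^ (s - 3 / 2)))
      (fun r : ℝ => besselShape β a ν r * (r : ℂ) ^ (2 * s - 1 / 2 - 3 / 2)) (Ioi 0) := fun s r hr => by
    simp only []
    rw [← ofReal_mul_sq_cpow hr s]; ring
  have hcont : ∀ s : ℂ, ContinuousOn (fun r : ℝ => besselShape β a ν r * (((r ^ 2 : ℝ)) : ℂ) ^ (s - 3 / 2)) (Ioi 0) := fun s => by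
    refine (continuousOn_besselShape β ha ν).mul fun r hr => ?_
    have h := Complex.continuousAt_ofReal_cpow_const (r ^ 2) (s - 3 / 2) (Or.inr (pow_ne_zero 2 (ne_of_gt hr)))
    exact (ContinuousAt.comp (f := fun r : ℝ => r ^ 2) (g := fun x : ℝ => (x : ℂ) ^ (s - 3 / 2)) h
      ((continuous_pow 2).continuousAt)).continuousWithinAt
  have hintR : ∀ s : ℂ, (|ν.im| + 1 / 2 - β.re) / 2 < s.re →
      IntegrableOn (fun r : ℝ => (r : ℂ) * (besselShape β a ν r * (((r ^ 2 : ℝ)) : ℂ) ^ (s - 3 / 2))) (Ioi 0) := fun s hs =>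
    (integrableOn_besselShape_mul ha (hre s hs)).congr_fun (hkey s).symm measurableSet_Ioi
  refine ⟨fun s hs => integrable_radial (hcont s) (hintR s hs), ?_⟩
  have h2π : (2 * Real.pi : ℂ) ≠ 0 := by exact_mod_cast (by positivity : (2 * Real.pi : ℝ) ≠ 0)
  have g1 := IsGammaProduct.const ((|ν.im| + 1 / 2 - β.re) / 2) (mul_ne_zero h2π two_ne_zero)
  have g2 := IsGammaProduct.cpow_ofReal ((|ν.im| + 1 / 2 - β.re) / 2) ha (-2) (1 / 2 - β)
  have g3 := IsGammaProduct.cpow_ofReal ((|ν.im| + 1 / 2 - β.re) / 2) two_pos 2 (β - 5 / 2)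
  have g4 := IsGammaProduct.Gamma_shift ((|ν.im| + 1 / 2 - β.re) / 2) ((β - 1 / 2 + Complex.I * ν) / 2)
  have g5 := IsGammaProduct.Gamma_shift ((|ν.im| + 1 / 2 - β.re) / 2) ((β - 1 / 2 - Complex.I * ν) / 2)
  refine ((((g1.mul g2).mul g3).mul g4).mul g5).congr fun s hs => ?_
  rw [integral_complex_radial (fun r : ℝ => besselShape β a ν r * (((r ^ 2 : ℝ)) : ℂ) ^ (s - 3 / 2)),
    setIntegral_congr_fun measurableSet_Ioi (hkey s),
    show 2 * s - 1 / 2 - 3 / 2 = (2 * s - 1 / 2) - 3 / 2 by ring, integral_besselShape_mul ha (hre s hs)]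
  push_cast
  ring_nf

end ComplexShapes

/-! ### 4. Mellin transforms over `K_∞ˣ` of product functions as Gamma products -/

section Product

open NumberField NumberField.InfinitePlace NumberField.mixedEmbedding

attribute [local instance] Literature.MeasureTheory.Group.Units.borelSpace_of_isOpenEmbedding
  Literature.MeasureTheory.Group.hasSummableGeomSeries_of_finiteDimensional

variable (K : Type*) [Field K] [NumberField K]

/-- **The Mellin transform over `K_∞ˣ` of a product of shape functions is a Gamma product.** If
`φ(u) = C ∏_w F_w(u_w) ∏_w G_w(u_w)` with `C ≠ 0`, measurable factors, and each local Mellin transform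
`∫_ℝ F_w |t|^{s-3/2}`, `∫_ℂ G_w (|z|²)^{s-3/2}` is integrable on a right half-plane and a Gamma product there,
then for a Haar measure `μ` on `K_∞ˣ`, `u ↦ φ(u) N(u)^{s-1/2}` is `μ`-integrable on a right half-plane and
`∫ φ N^{s-1/2} dμ` is a Gamma product there. [cite: JacquetLanglands1970, §5 Thm. 5.15, §6 Thm. 6.4, and proof of Thm. 11.1 (p. 173)] -/
theorem isGammaProduct_mellin_units_of_prod (μ : Measure (mixedSpace K)ˣ) [μ.IsHaarMeasure]
    (F : {w : InfinitePlace K // IsReal w} → ℝ → ℂ) (G : {w : InfinitePlace K // IsComplex w} → ℂ → ℂ)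
    (xF : {w : InfinitePlace K // IsReal w} → ℝ) (xG : {w : InfinitePlace K // IsComplex w} → ℝ)
    (hFm : ∀ w, Measurable (F w)) (hGm : ∀ w, Measurable (G w))
    (hF : ∀ w, (∀ s : ℂ, xF w < s.re → Integrable fun t : ℝ => F w t * ((|t| : ℝ) : ℂ) ^ (s - 3 / 2)) ∧
      IsGammaProduct (xF w) (fun s => ∫ t : ℝ, F w t * ((|t| : ℝ) : ℂ) ^ (s - 3 / 2)))
    (hG : ∀ w, (∀ s : ℂ, xG w < s.re → Integrable fun z : ℂ => G w z * ((‖z‖ ^ 2 : ℝ) : ℂ) ^ (s - 3 / 2)) ∧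
      IsGammaProduct (xG w) (fun s => ∫ z : ℂ, G w z * ((‖z‖ ^ 2 : ℝ) : ℂ) ^ (s - 3 / 2)))
    {C : ℂ} (hC : C ≠ 0) (φ : (mixedSpace K)ˣ → ℂ)
    (hφ : ∀ u, φ u = C * ((∏ w, F w ((u : mixedSpace K).1 w)) * ∏ w, G w ((u : mixedSpace K).2 w))) :
    ∃ x₀ : ℝ, (∀ s : ℂ, x₀ < s.re →
        Integrable (fun u : (mixedSpace K)ˣ => φ u * ((mixedEmbedding.norm (u : mixedSpace K) : ℝ) : ℂ) ^ (s - 1 / 2)) μ) ∧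
      IsGammaProduct x₀ (fun s => ∫ u : (mixedSpace K)ˣ, φ u * ((mixedEmbedding.norm (u : mixedSpace K) : ℝ) : ℂ) ^ (s - 1 / 2) ∂μ) := by
  set x₀ : ℝ := (∑ w, |xF w|) + ∑ w, |xG w| with hx₀
  have hxF : ∀ w, xF w ≤ x₀ := fun w =>
    ((le_abs_self _).trans (Finset.single_le_sum (f := fun w => |xF w|) (fun _ _ => abs_nonneg _) (Finset.mem_univ w))).trans
      (le_add_of_nonneg_right (Finset.sum_nonneg fun _ _ => abs_nonneg _))
  have hxG : ∀ w, xG w ≤ x₀ := fun w =>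
    ((le_abs_self _).trans (Finset.single_le_sum (f := fun w => |xG w|) (fun _ _ => abs_nonneg _) (Finset.mem_univ w))).trans
      (le_add_of_nonneg_left (Finset.sum_nonneg fun _ _ => abs_nonneg _))
  obtain ⟨c, hc, H⟩ := integrable_and_integral_units_prod_mul_norm_cpow K μ
  have hφ' : (fun u : (mixedSpace K)ˣ => φ u * ((mixedEmbedding.norm (u : mixedSpace K) : ℝ) : ℂ) ^ (0 : ℂ)) = fun u => φ u := by
    funext u; rw [Complex.cpow_zero, mul_one]
  refine ⟨x₀, fun s hs => ?_, ?_⟩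
  · obtain ⟨hint, -⟩ := H F G s hFm hGm (fun w => (hF w).1 s (lt_of_le_of_lt (hxF w) hs)) (fun w => (hG w).1 s (lt_of_le_of_lt (hxG w) hs))
    have h := hint.const_mul C
    refine h.congr (Eventually.of_forall fun u => ?_)
    simp only [hφ u]; ring
  · have hprodF := IsGammaProduct.finset_prod (x₀ := x₀) Finset.univ (F := fun w s => ∫ t : ℝ, F w t * ((|t| : ℝ) : ℂ) ^ (s - 3 / 2))
      fun w _ => (hF w).2.mono (hxF w)
    have hprodG := IsGammaProduct.finset_prod (x₀ := x₀) Finset.univ (F := fun w s => ∫ z : ℂ, G w z * ((‖z‖ ^ 2 : ℝ) : ℂ) ^ (s - 3 / 2))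
      fun w _ => (hG w).2.mono (hxG w)
    have hcC : C * (c : ℂ) ≠ 0 := mul_ne_zero hC (Complex.ofReal_ne_zero.mpr hc.ne')
    refine (((IsGammaProduct.const x₀ hcC).mul hprodF).mul hprodG).congr fun s hs => ?_
    obtain ⟨hint, hval⟩ := H F G s hFm hGm (fun w => (hF w).1 s (lt_of_le_of_lt (hxF w) hs)) (fun w => (hG w).1 s (lt_of_le_of_lt (hxG w) hs))
    have e : (fun u : (mixedSpace K)ˣ => φ u * ((mixedEmbedding.norm (u : mixedSpace K) : ℝ) : ℂ) ^ (s - 1 / 2)) =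
        fun u : (mixedSpace K)ˣ => C * (((∏ w, F w (((u : (mixedSpace K)ˣ) : mixedSpace K).1 w)) *
          ∏ w, G w (((u : (mixedSpace K)ˣ) : mixedSpace K).2 w)) *
          ((mixedEmbedding.norm ((u : (mixedSpace K)ˣ) : mixedSpace K) : ℝ) : ℂ) ^ (s - 1 / 2)) := by
      funext u; rw [hφ u]; ring
    change ∫ u : (mixedSpace K)ˣ, φ u * ((mixedEmbedding.norm (u : mixedSpace K) : ℝ) : ℂ) ^ (s - 1 / 2) ∂μ = _
    rw [e, integral_const_mul, hval]
    ring

end Product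

end Literature.NumberTheory.Automorphic
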